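import Literature.NumberTheory.Deninger2022.ArithmeticCohomology
import Literature.NumberTheory.LFunctions.ZetaScrewThm17Proofs
import Literature.NumberTheory.LFunctions.ZetaPartialSumAtZeros

/-!
# The partner involution and the sign on the multiplicity index set; the weight condition is the Riemann Hypothesis (motivic door, cc-4 gen 3, part 2)

Part 1 (`Theorems/MotivicDoorDeningerHodgeTwist.lean`) realises Deninger's (2.1) (2.5) (2.6) and all
of (2.7) except `∗θ = θ∗` on any diagonal carrier `ι →₀ ℂ`, given an involution `σ` of the index set
with `w ∘ σ = 1 - w` and a sign `s = ±1` with `s ∘ σ = -s`, and shows `∗θ = θ∗ ↔ ∀ j,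
conj (w (σ j)) = w j`.  Here we supply `σ` and `s` on the index set of the spectrum model with
multiplicities, `Σ α : ℂ, Fin (zetaMultiplicity α)` (`m(α)` basis vectors of weight `α`, `m` = order
of `ζ` at a non-trivial zero, `0` elsewhere; C. Deninger, arXiv:2204.02714 §2 (2.3)):

* `zetaMultiplicity_one_sub` : `m(1 - α) = m(α)` for every `α` (functional equation,
  `riemannZetaZeroOrder_one_sub`; `ZetaZeros.riemannZetaNontrivialZeros.one_sub_mem`);
* `partner (ρ, j) = (1 - ρ, j)`, an involution (`partner_involutive`) with weight `1 - ρ`;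
* `sgn (ρ, j) = +1` if `Im ρ > 0`, `-1` otherwise; odd under `partner` (`sgn_partner`) because
  non-trivial zeros are non-real (`ZetaZeros.riemannZetaNontrivialZeros.im_ne_zero`: `ζ ≠ 0` on the
  real segment `(0,1)`).

All of this is UNCONDITIONAL.  The weight condition of part 1 on this index set,
`∀ j, conj (1 - ρ_j) = ρ_j`, is EXACTLY the Riemann Hypothesis (`conj_partner_iff_riemannHypothesis`:
every non-trivial zero occurs as a weight since `m(ρ) ≥ 1`, `zetaMultiplicity_pos_iff`).

Honest grade: bookkeeping on the zero multiset; nothing about `ζ` beyond the cited symmetries.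
Labels: every `theorem` PROVED (kernel).
References: C. Deninger, arXiv:2204.02714 §2 (2.3), (2.6); E. C. Titchmarsh, The theory of the
Riemann zeta-function, 2nd ed. (1986) §2.12.
-/

set_option linter.dupNamespace false

noncomputable section

open Complex
open Literature.NumberTheory.LFunctions Literature.NumberTheory.Deninger2022

namespace Summit.RiemannHypothesis.RiemannHypothesis.Theorems.MotivicDoor.DeningerPartner

/-! ## The multiplicity index set `Σ α, Fin (m α)`: partner involution and sign -/

open ZetaZeros.riemannZetaNontrivialZeros

/-- `m(α) > 0` exactly at the non-trivial zeros. -/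
theorem zetaMultiplicity_pos_iff (α : ℂ) :
    0 < zetaMultiplicity α ↔ α ∈ ZetaZeros.riemannZetaNontrivialZeros := by
  unfold zetaMultiplicity
  by_cases h : α ∈ ZetaZeros.riemannZetaNontrivialZeros
  · rw [if_pos h]
    simp only [h, iff_true]
    exact Int.lt_toNat.mpr (by exact_mod_cast one_le_order h)
  · rw [if_neg h]
    simp [h]

/-- **`m(1 - α) = m(α)` for every `α`** (functional equation, `riemannZetaZeroOrder_one_sub`; both
sides vanish off the non-trivial zeros, which are stable under `ρ ↦ 1 - ρ`). -/
theorem zetaMultiplicity_one_sub (α : ℂ) : zetaMultiplicity (1 - α) = zetaMultiplicity α := by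
  unfold zetaMultiplicity
  by_cases h : α ∈ ZetaZeros.riemannZetaNontrivialZeros
  · rw [if_pos h, if_pos (one_sub_mem h), riemannZetaZeroOrder_one_sub_holds (re_pos h) (re_lt_one h)]
  · have h' : 1 - α ∉ ZetaZeros.riemannZetaNontrivialZeros := fun h1 => h (by
      simpa using one_sub_mem h1)
    rw [if_neg h, if_neg h']

/-- The **partner involution** of the multiplicity index set: the `j`-th basis vector of weight `ρ`
is paired with the `j`-th basis vector of weight `1 - ρ`. -/
def partner (i : Σ α : ℂ, Fin (zetaMultiplicity α)) : Σ α : ℂ, Fin (zetaMultiplicity α) :=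
  ⟨1 - i.1, Fin.cast (zetaMultiplicity_one_sub i.1).symm i.2⟩

/-- The partner has weight `1 - ρ`. -/
@[simp] theorem partner_fst (i : Σ α : ℂ, Fin (zetaMultiplicity α)) : (partner i).1 = 1 - i.1 := rfl

/-- The partner keeps the position inside the fibre. -/
@[simp] theorem partner_snd_val (i : Σ α : ℂ, Fin (zetaMultiplicity α)) :
    ((partner i).2 : ℕ) = (i.2 : ℕ) := rfl

/-- `partner` is an involution. -/
theorem partner_partner (i : Σ α : ℂ, Fin (zetaMultiplicity α)) : partner (partner i) = i := by
  obtain ⟨ρ, j⟩ := i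
  refine Sigma.ext (by simp) ?_
  exact (Fin.heq_ext_iff (by simp)).2 (by simp)

/-- `partner` is an involution. -/
theorem partner_involutive : Function.Involutive partner := partner_partner

/-- The **sign**: `+1` on basis vectors whose weight lies in the upper half plane, `-1` in the lower. -/
def sgn (i : Σ α : ℂ, Fin (zetaMultiplicity α)) : ℂ := if 0 < i.1.im then 1 else -1

/-- `sgn = ±1`. -/
theorem sgn_cases (i : Σ α : ℂ, Fin (zetaMultiplicity α)) : sgn i = 1 ∨ sgn i = -1 := by
  unfold sgn
  split_ifs <;> simp

/-- **`sgn` is odd under `partner`**: `Im (1 - ρ) = - Im ρ` and `Im ρ ≠ 0` for a non-trivial zero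
(`ζ` has no zeros on the real segment `(0,1)`). -/
theorem sgn_partner (i : Σ α : ℂ, Fin (zetaMultiplicity α)) : sgn (partner i) = -sgn i := by
  have hmem : i.1 ∈ ZetaZeros.riemannZetaNontrivialZeros :=
    (zetaMultiplicity_pos_iff i.1).1 (Fin.pos i.2)
  have him : i.1.im ≠ 0 := im_ne_zero hmem
  simp only [sgn, partner_fst, Complex.sub_im, Complex.one_im, zero_sub, Left.neg_pos_iff]
  by_cases h : 0 < i.1.im
  · rw [if_pos h, if_neg (not_lt.mpr h.le)]
  · rw [if_neg h, if_pos (lt_of_le_of_ne (not_lt.mp h) him), neg_neg]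

/-- With `w ∘ σ = 1 - w` the weight condition reads `Re w = 1/2`: `conj (1 - z) = z ↔ Re z = 1/2`. -/
theorem conj_one_sub_eq_self_iff (z : ℂ) : starRingEnd ℂ (1 - z) = z ↔ z.re = 1 / 2 := by
  constructor
  · intro h
    have h' := congrArg Complex.re h
    simp only [Complex.conj_re, Complex.sub_re, Complex.one_re] at h'
    linarith
  · intro h
    apply Complex.ext
    · simp only [Complex.conj_re, Complex.sub_re, Complex.one_re, h]
      norm_num
    · simp only [Complex.conj_im, Complex.sub_im, Complex.one_im, zero_sub, neg_neg]

/-- **The weight condition on the multiplicity index set is the Riemann Hypothesis**: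
`conj (1 - ρ_j) = ρ_j` for every index `j` (every non-trivial zero, each occurring `m(ρ)` times)
iff RH. -/
theorem conj_partner_iff_riemannHypothesis :
    (∀ j : Σ α : ℂ, Fin (zetaMultiplicity α), starRingEnd ℂ ((partner j).1) = j.1) ↔
      RiemannHypothesis := by
  constructor
  · intro h
    refine riemannHypothesis_of_forall_re (fun ρ hρ => ?_)
    have hm : 0 < zetaMultiplicity ρ := (zetaMultiplicity_pos_iff ρ).2 hρ
    have hj := h ⟨ρ, ⟨0, hm⟩⟩
    rw [partner_fst] at hj
    exact (conj_one_sub_eq_self_iff ρ).1 hj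
  · intro hRH j
    rw [partner_fst]
    exact (conj_one_sub_eq_self_iff j.1).2 (ZetaScrewThm17.re_eq_half_of_RH hRH
      ((zetaMultiplicity_pos_iff j.1).1 (Fin.pos j.2)))

end Summit.RiemannHypothesis.RiemannHypothesis.Theorems.MotivicDoor.DeningerPartner
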